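import Mathlib.Geometry.Euclidean.Volume.Measure
import Mathlib.Geometry.Manifold.Instances.Sphere
import Mathlib.Analysis.Calculus.MeanValue
import HarnessLib

/-!
# The Hausdorff measure of a round sphere is finite

Support file (all results proved) for the identification of the spherical Hausdorff measure with
the polar-coordinate surface measure (`SphereMeasure.lean`), a step of Bartnik's existence
theorem for the ADM energy (`Literature.Geometry.Lorentzian.AFEnd.HasADMEnergy_of_isAsymptoticallyFlat`).

Let `E` be a real inner product space of dimension `d + 1`. We prove that the `d`-dimensional
Hausdorff measure of every sphere `{‖x‖ = r}` is finite (`hausdorffMeasure_sphere_lt_top`,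
`euclideanHausdorffMeasure_sphere_lt_top`), without any area formula: the closed hemisphere
`{⟪v, x⟫ ≤ 0}` opposite to a unit vector `v` is the image of the disc of radius `2` in `vᗮ`
(a `d`-dimensional inner product space, where `μH[d]` is a Haar measure, finite on compact sets)
under Mathlib's inverse stereographic projection `stereoInvFunAux v`, which is smooth, hence
Lipschitz on that disc; Lipschitz maps increase `μH[d]` by at most a constant factor
(`LipschitzOnWith.hausdorffMeasure_image_le`), and two hemispheres cover the sphere.

Mathlib has the finiteness of `μH[dim E]` on compact subsets of `E` (it is a Haar measure) but
nothing on lower-dimensional Hausdorff measures of curved sets.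

## References

* P. Mattila, *Geometry of sets and measures in Euclidean spaces*, CUP 1995, §4 (Hausdorff
  measures; 4.3, Lipschitz images).
* H. Federer, *Geometric measure theory* (1969), 2.10.11, 3.2.
-/

noncomputable section

open Set Function Metric Module Submodule
open _root_.MeasureTheory _root_.MeasureTheory.Measure
open scoped ENNReal NNReal Topology RealInnerProductSpace Pointwise

namespace Literature.MeasureTheory.Hausdorff

variable {E : Type*} [NormedAddCommGroup E] [InnerProductSpace ℝ E] [FiniteDimensional ℝ E]
  [MeasurableSpace E] [BorelSpace E]

/-- On a `d`-dimensional subspace `K` of `E`, the ambient Hausdorff measure `μH[d]` of a bounded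
piece of `K` is finite: the inclusion is an isometry, and `μH[d]` on `K` is a Haar measure
(Mathlib's `isAddHaarMeasure_hausdorffMeasure`). [folklore] -/
theorem hausdorffMeasure_subspace_inter_closedBall_lt_top (K : Submodule ℝ E) {d : ℕ}
    (hK : finrank ℝ K = d) (R : ℝ) :
    μH[d] ((K : Set E) ∩ closedBall 0 R) < ∞ := by
  have hiso : Isometry (K.subtype : K → E) := K.subtypeₗᵢ.isometry
  have hset : (K : Set E) ∩ closedBall 0 R = (K.subtype : K → E) '' closedBall (0 : K) R := by
    ext x
    simp only [mem_inter_iff, SetLike.mem_coe, mem_closedBall, dist_zero_right, mem_image]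
    constructor
    · rintro ⟨hxK, hxR⟩
      exact ⟨⟨x, hxK⟩, by simpa using hxR, rfl⟩
    · rintro ⟨y, hy, rfl⟩
      exact ⟨y.2, by simpa using hy⟩
  rw [hset, hiso.hausdorffMeasure_image (Or.inl (Nat.cast_nonneg d))]
  have hHaar : IsAddHaarMeasure (μH[(d : ℝ)] : Measure K) := by
    have h := isAddHaarMeasure_hausdorffMeasure (E := K)
    rwa [hK] at h
  exact (isCompact_closedBall (0 : K) R).measure_lt_top

/-- **The closed hemisphere opposite to a unit vector has finite Hausdorff measure.** For a unit
vector `v` of a `(d+1)`-dimensional inner product space, `μH[d] {x | ‖x‖ = 1, ⟪v, x⟫ ≤ 0} < ∞`: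
this hemisphere is the image of the disc `vᗮ ∩ B̄(0, 2)` under the smooth inverse stereographic
projection `stereoInvFunAux v` (by `stereo_left_inv`, since the stereographic coordinate of such
a point `x` is `(2 / (1 - ⟪v, x⟫)) · P_{vᗮ} x`, of norm `≤ 2`), which is Lipschitz on that disc
(mean value inequality), and Lipschitz maps expand `μH[d]` by at most a factor. [folklore] -/
theorem hausdorffMeasure_sphere_inter_inner_nonpos_lt_top {d : ℕ} (hd : finrank ℝ E = d + 1)
    {v : E} (hv : ‖v‖ = 1) :
    μH[d] (sphere (0 : E) 1 ∩ {x | ⟪v, x⟫ ≤ 0}) < ∞ := by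
  haveI : Fact (finrank ℝ E = d + 1) := ⟨hd⟩
  have hv0 : v ≠ 0 := fun h ↦ by simp [h] at hv
  set K : Submodule ℝ E := (ℝ ∙ v)ᗮ with hK_def
  have hK : finrank ℝ K = d := finrank_orthogonal_span_singleton hv0
  set T : Set E := (K : Set E) ∩ closedBall 0 2 with hT_def
  -- the hemisphere is the image of `T`
  have hsub : sphere (0 : E) 1 ∩ {x | ⟪v, x⟫ ≤ 0} ⊆ stereoInvFunAux v '' T := by
    rintro x ⟨hxS, hxv⟩
    simp only [mem_setOf_eq] at hxv
    have hx1 : ‖x‖ = 1 := by simpa using hxS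
    have hxne : x ≠ v := fun h ↦ by
      rw [h, real_inner_self_eq_norm_sq, hv] at hxv
      norm_num at hxv
    have ha : 0 < 1 - ⟪v, x⟫ := by linarith
    set w : K := stereoToFun v x with hw_def
    have hw2 : ‖w‖ ≤ 2 := by
      have hP : ‖(ℝ ∙ v)ᗮ.orthogonalProjectionOnto x‖ ≤ 1 :=
        hx1 ▸ Submodule.norm_orthogonalProjectionOnto_apply_le (ℝ ∙ v)ᗮ x
      have hn : ‖w‖ = |2 / (1 - ⟪v, x⟫)| * ‖(ℝ ∙ v)ᗮ.orthogonalProjectionOnto x‖ := by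
        simp only [hw_def, stereoToFun_apply, norm_smul, Real.norm_eq_abs, innerSL_apply_apply]
      rw [hn, abs_of_pos (div_pos two_pos ha)]
      calc 2 / (1 - ⟪v, x⟫) * ‖(ℝ ∙ v)ᗮ.orthogonalProjectionOnto x‖
          ≤ 2 / (1 - ⟪v, x⟫) * 1 := by gcongr
        _ ≤ 2 := by
          rw [mul_one, div_le_iff₀ ha]
          linarith
    refine ⟨(w : E), ⟨w.2, ?_⟩, ?_⟩
    · -- `‖w‖ ≤ 2`
      rw [mem_closedBall, dist_zero_right]
      exact hw2
    · -- `stereoInvFunAux v w = x`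
      exact congrArg Subtype.val (stereo_left_inv hv (x := ⟨x, hxS⟩) hxne)
  -- `stereoInvFunAux v` is Lipschitz on the convex compact set `closedBall 0 2 ⊇ T`
  obtain ⟨C, hC⟩ : ∃ C, ∀ y ∈ closedBall (0 : E) 2, ‖fderiv ℝ (stereoInvFunAux v) y‖ ≤ C :=
    (isCompact_closedBall (0 : E) 2).exists_bound_of_continuousOn
      ((contDiff_stereoInvFunAux (m := 1) (v := v)).continuous_fderiv one_ne_zero).continuousOn
  have hLip : LipschitzOnWith (Real.toNNReal C) (stereoInvFunAux v) T := by
    refine (Convex.lipschitzOnWith_of_nnnorm_fderiv_le (𝕜 := ℝ)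
      (fun y _ ↦ (contDiff_stereoInvFunAux (m := 1) (v := v)).differentiable one_ne_zero y)
      (fun y hy ↦ ?_) (convex_closedBall (0 : E) 2)).mono inter_subset_right
    rw [← NNReal.coe_le_coe, coe_nnnorm, Real.coe_toNNReal']
    exact (hC y hy).trans (le_max_left _ _)
  have himage := hLip.hausdorffMeasure_image_le (d := d) (Nat.cast_nonneg d)
  have hT : μH[d] T < ∞ := hausdorffMeasure_subspace_inter_closedBall_lt_top K hK 2
  calc μH[d] (sphere (0 : E) 1 ∩ {x | ⟪v, x⟫ ≤ 0})
      ≤ μH[d] (stereoInvFunAux v '' T) := measure_mono hsub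
    _ ≤ (Real.toNNReal C : ℝ≥0∞) ^ (d : ℝ) * μH[d] T := himage
    _ < ∞ := ENNReal.mul_lt_top (ENNReal.rpow_lt_top_of_nonneg (Nat.cast_nonneg d)
        ENNReal.coe_ne_top) hT

/-- **The unit sphere of a `(d+1)`-dimensional inner product space has finite `d`-dimensional
Hausdorff measure** (two opposite closed hemispheres cover it). [folklore] -/
theorem hausdorffMeasure_unitSphere_lt_top {d : ℕ} (hd : finrank ℝ E = d + 1) :
    μH[d] (sphere (0 : E) 1) < ∞ := by
  have hnt : Nontrivial E := Module.nontrivial_of_finrank_pos (R := ℝ) (by omega)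
  obtain ⟨v, hv⟩ := (NormedSpace.sphere_nonempty (E := E) (x := 0) (r := 1)).2 zero_le_one
  have hv1 : ‖v‖ = 1 := by simpa using hv
  have hv1' : ‖-v‖ = 1 := by rw [norm_neg, hv1]
  have hcover : sphere (0 : E) 1 ⊆
      (sphere (0 : E) 1 ∩ {x | ⟪v, x⟫ ≤ 0}) ∪ (sphere (0 : E) 1 ∩ {x | ⟪-v, x⟫ ≤ 0}) := by
    intro x hx
    by_cases h : ⟪v, x⟫ ≤ 0
    · exact Or.inl ⟨hx, h⟩
    · refine Or.inr ⟨hx, ?_⟩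
      simp only [mem_setOf_eq, inner_neg_left, neg_nonpos]
      exact (not_le.1 h).le
  calc μH[d] (sphere (0 : E) 1)
      ≤ μH[d] (sphere (0 : E) 1 ∩ {x | ⟪v, x⟫ ≤ 0}) + μH[d] (sphere (0 : E) 1 ∩ {x | ⟪-v, x⟫ ≤ 0}) :=
        (measure_mono hcover).trans (measure_union_le _ _)
    _ < ∞ := ENNReal.add_lt_top.2 ⟨hausdorffMeasure_sphere_inter_inner_nonpos_lt_top hd hv1,
        hausdorffMeasure_sphere_inter_inner_nonpos_lt_top hd hv1'⟩

omit [FiniteDimensional ℝ E] [MeasurableSpace E] [BorelSpace E] in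
/-- The sphere of radius `r > 0` is the `r`-dilate of the unit sphere. [folklore] -/
theorem smul_unitSphere {r : ℝ} (hr : 0 < r) : r • sphere (0 : E) 1 = sphere (0 : E) r := by
  ext x
  simp only [Set.mem_smul_set, mem_sphere_iff_norm, sub_zero]
  constructor
  · rintro ⟨y, hy, rfl⟩
    rw [norm_smul, hy, mul_one, Real.norm_eq_abs, abs_of_pos hr]
  · intro hx
    refine ⟨r⁻¹ • x, ?_, by rw [smul_inv_smul₀ hr.ne']⟩
    rw [norm_smul, norm_inv, Real.norm_eq_abs, abs_of_pos hr, hx, inv_mul_cancel₀ hr.ne']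

/-- **Every sphere of a `(d+1)`-dimensional inner product space has finite `d`-dimensional
Hausdorff measure** (scaling `μH[d] (r • s) = r^d μH[d] s` for `r > 0`; for `r ≤ 0` the sphere is
a subsingleton). [folklore] -/
theorem hausdorffMeasure_sphere_lt_top {d : ℕ} (hd : finrank ℝ E = d + 1) (r : ℝ) :
    μH[d] (sphere (0 : E) r) < ∞ := by
  rcases lt_trichotomy r 0 with hr | rfl | hr
  · rw [sphere_eq_empty_of_neg hr, measure_empty]
    exact ENNReal.zero_lt_top
  · rw [sphere_zero]
    exact (hausdorffMeasure_le_one_of_subsingleton subsingleton_singleton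
      (Nat.cast_nonneg d)).trans_lt ENNReal.one_lt_top
  · rw [← smul_unitSphere hr, Measure.hausdorffMeasure_smul₀ (Nat.cast_nonneg d) hr.ne']
    exact ENNReal.nnreal_smul_lt_top (hausdorffMeasure_unitSphere_lt_top hd)

/-- **Every sphere of a `(d+1)`-dimensional inner product space has finite Euclidean
(normalised) Hausdorff measure `μHE[d]`** (a finite multiple of `μH[d]`). [folklore] -/
theorem euclideanHausdorffMeasure_sphere_lt_top {d : ℕ} (hd : finrank ℝ E = d + 1) (r : ℝ) :
    (μHE[d] : Measure E) (sphere (0 : E) r) < ∞ := by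
  rw [euclideanHausdorffMeasure_def, Measure.smul_apply]
  exact ENNReal.nnreal_smul_lt_top (hausdorffMeasure_sphere_lt_top hd r)

end Literature.MeasureTheory.Hausdorff

end
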